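import Mathlib.FieldTheory.KummerExtension
import Mathlib.RingTheory.RootsOfUnity.Complex
import Mathlib.Analysis.SpecialFunctions.Trigonometric.Basic
import Mathlib.Analysis.SpecialFunctions.Pow.Real
import Literature.NumberTheory.DiophantineApproximation.GeneralizedPolynomialsUDSufficiency
import HarnessLib

/-!
# The harmonic (one-loop) defect of the twisted slab: time-circle determinant and the bound `4·#modes·e^{−ω_min t}`

HELPER toward stub **T1** `TwistedSlabAnchor` (LINE `twisted-slab-continuity`, crux `IRcof` stmt-QuantumFields-26930, census row 43;
LEAD prover ym-ir-line-tsc-p1 g2; `--supports` the crux, `--as helper`).  Brick (M2) of the T1-TREE-EXACT roadmap (bus 2026-08-28,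
HOME `pub/ym-ir/ym-ir-line-tsc-p1/HANDOFF.md`): the ARITHMETIC ENDPOINT of the `β → ∞` (Laplace–Morse–Bott) evaluation of
`projSlabDefect` at a fixed box, everything else being the critical manifold (K2, files `…TwistedSlabGauge` … `…TwistedSlabVacuumOrbits`),
the transversal Hessian (lit-4: `TwistedTorusOneFormGap`, `DiscreteWeitzenboeckIdentity`), the fibred Laplace method
(`Literature.Analysis.Asymptotics.tendsto_laplaceMethod_fibred`) and the slice ∕ tubular step on `SU(N)^E` (open).

* §1 ★ `prod_sq_add_one_sub_cos` ∕ `prod_two_cosh_sub_two_cos` — **the time-circle determinant**: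
  `∏_{q<t} (2 cosh ω − 2 cos(2πq/t)) = 2 cosh(tω) − 2 = e^{tω}(1 − e^{−tω})²` (`two_cosh_sub_two`): the determinant of
  `−Δ_{ℤ/t} + (2 cosh ω − 2)` (the quadratic fluctuation operator of ONE normal mode of spatial eigenvalue `λ = 2 cosh ω − 2` around the
  time circle of period `t`), via `X^t − 1 = ∏ (X − ζ^q)` at a real point and its conjugate.  Consequently the Gaussian weight of one mode
  is `∝ (2 sinh(ωt/2))^{−1} = e^{−ωt/2}/(1 − e^{−ωt})` (a harmonic oscillator at inverse temperature `t`), and the period-doubling ratio of the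
  one-loop slab partition functions is `∏_λ ((1 − e^{−ω_λ t})/(1 + e^{−ω_λ t}))²` (square = two polarisations).
* §2 ★★ `harmonicDefect_le` — **the harmonic defect obeys T1's bound with UNIFORM constants**: for any finite family of rates
  `ω_λ ≥ ω_min` and `t ≥ 0`, `1 − ∏_λ ((1 − e^{−ω_λ t})/(1 + e^{−ω_λ t}))² ≤ 4 · #{λ} · e^{−ω_min t}` (the tree's `HalandUD.one_sub_prod_le_sum`,
  `1 − ((1−q)/(1+q))² = 4q/(1+q)² ≤ 4q`).  For the e₂-projected twisted slab `ℓ₀ × ℓ₀ × L × t` of `SU(N)`: `#{λ} = (N²−1)·ℓ₀²·L` adjoint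
  0-form modes of the twisted 3-tube and `cosh ω_min = 1 + 2 sin²(π/(Nℓ₀))` (lit-4 `twistedTube_poincare_sharp`), i.e. EXACTLY the shape
  `C·L·e^{−ct}` of `TwistedSlabAnchor` with `(c, C) = (ω_min, 4(N²−1)ℓ₀²)` independent of `β`, `L`, `t`.

HONEST FRAMING: elementary real ∕ complex algebra; by itself a statement about the ONE-LOOP model, not about `projSlabDefect` (the link is
the roadmap above, whose slice step and whose `β`-UNIFORM version — T1-box, a semiclassical transfer-operator bound — are OPEN); T1 proper
0∕1; nothing here bears on `IRcof`, `IR`, or the Yang–Mills mass gap (Clay: NOT proved); R4 = `BalabanLadder.UV` only.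
References (mechanism): M. Lüscher, Nucl. Phys. B219 (1983) 233 (femto-universe, harmonic modes); A. González-Arroyo, C. P. Korthals Altes,
Nucl. Phys. B311 (1988) 433 (twisted box, gluon spectrum at tree level); M. García Pérez, A. González-Arroyo, M. Okawa, JHEP 10 (2017) 150
§2.5 (Feynman-gauge propagator `δ_{μν}/q̂²` around the twist eater).
-/

set_option autoImplicit false

open Finset Complex

namespace Summit.QuantumFields.YangMills.Cruxes.IRcof.TwistedSlab

/-! ## §1 The time-circle determinant -/

/-- `∏_{q<t} (u − ζ^q) = u^t − 1` for a primitive `t`-th root `ζ` (evaluation of Mathlib's `X^t − 1 = ∏ (X − ζ^q)`). [folklore] -/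
theorem prod_sub_pow_primitiveRoot {K : Type*} [CommRing K] [IsDomain K] {ζ : K} {t : ℕ} (hζ : IsPrimitiveRoot ζ t)
    (ht : 0 < t) (u : K) : ∏ q ∈ range t, (u - ζ ^ q) = u ^ t - 1 := by
  have h := congrArg (Polynomial.eval u) (X_pow_sub_C_eq_prod hζ (α := 1) (a := 1) ht (one_pow t))
  simp only [Polynomial.eval_sub, Polynomial.eval_pow, Polynomial.eval_X, Polynomial.eval_C, Polynomial.eval_prod,
    mul_one] at h
  exact h.symm

/-- `(u − z)(u − conj z) = u² − 2u·Re z + 1` for real `u` and `|z| = 1`. [folklore] -/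
theorem mul_conj_factor (u : ℝ) {z : ℂ} (hz : ‖z‖ = 1) :
    ((u : ℂ) - z) * ((u : ℂ) - starRingEnd ℂ z) = ((u ^ 2 - 2 * u * z.re + 1 : ℝ) : ℂ) := by
  have h1 : z * starRingEnd ℂ z = 1 := by
    rw [Complex.mul_conj, Complex.normSq_eq_norm_sq, hz]; norm_num
  have h2 : z + starRingEnd ℂ z = ((2 * z.re : ℝ) : ℂ) := Complex.add_conj z
  calc ((u : ℂ) - z) * ((u : ℂ) - starRingEnd ℂ z) = (u : ℂ) ^ 2 - (u : ℂ) * (z + starRingEnd ℂ z) + z * starRingEnd ℂ z := by ring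
    _ = ((u ^ 2 - 2 * u * z.re + 1 : ℝ) : ℂ) := by rw [h1, h2]; push_cast; ring

/-- ★ **The cycle determinant**: `∏_{q<t} (u² + 1 − 2u cos(2πq/t)) = (u^t − 1)²` (`t ≥ 1`, real `u`). [folklore] -/
theorem prod_sq_add_one_sub_cos (u : ℝ) {t : ℕ} (ht : 0 < t) :
    ∏ q ∈ range t, (u ^ 2 - 2 * u * Real.cos (2 * Real.pi * q / t) + 1) = (u ^ t - 1) ^ 2 := by
  have hζ := Complex.isPrimitiveRoot_exp t ht.ne'
  set ζ := Complex.exp (2 * Real.pi * I / t) with hζdef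
  -- real parts and norms of the powers
  have hre : ∀ q : ℕ, (ζ ^ q).re = Real.cos (2 * Real.pi * q / t) := by
    intro q
    rw [hζdef, ← Complex.exp_nat_mul, show (q : ℂ) * (2 * Real.pi * I / t) = ((2 * Real.pi * q / t : ℝ) : ℂ) * I by
      push_cast; ring, Complex.exp_ofReal_mul_I_re]
  have hnorm : ∀ q : ℕ, ‖ζ ^ q‖ = 1 := by
    intro q; rw [norm_pow, hζdef, show (2 * Real.pi * I / t : ℂ) = ((2 * Real.pi / t : ℝ) : ℂ) * I by push_cast; ring,
      Complex.norm_exp_ofReal_mul_I, one_pow]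
  -- the complex identity
  have hC : (((∏ q ∈ range t, (u ^ 2 - 2 * u * Real.cos (2 * Real.pi * q / t) + 1) : ℝ)) : ℂ) = (((u ^ t - 1) ^ 2 : ℝ) : ℂ) := by
    rw [Complex.ofReal_prod]
    have step : ∀ q ∈ range t, (((u ^ 2 - 2 * u * Real.cos (2 * Real.pi * q / t) + 1 : ℝ)) : ℂ) =
        ((u : ℂ) - ζ ^ q) * ((u : ℂ) - starRingEnd ℂ (ζ ^ q)) := by
      intro q _; rw [mul_conj_factor u (hnorm q), hre q]
    rw [Finset.prod_congr rfl step, Finset.prod_mul_distrib, prod_sub_pow_primitiveRoot hζ ht]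
    have hconj : ∏ q ∈ range t, ((u : ℂ) - starRingEnd ℂ (ζ ^ q)) = starRingEnd ℂ (∏ q ∈ range t, ((u : ℂ) - ζ ^ q)) := by
      rw [map_prod]; refine Finset.prod_congr rfl fun q _ => ?_; rw [map_sub, Complex.conj_ofReal]
    rw [hconj, prod_sub_pow_primitiveRoot hζ ht, map_sub, map_pow, Complex.conj_ofReal, map_one]
    push_cast; ring
  exact_mod_cast hC

/-- ★ **`∏_{q<t} (2 cosh ω − 2 cos(2πq/t)) = 2 cosh(tω) − 2`** — the determinant of `−Δ_{ℤ/t} + (2 cosh ω − 2)` (eigenvalues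
`2 − 2cos(2πq/t)` of the cycle Laplacian shifted by the mode's spatial eigenvalue `λ = 2 cosh ω − 2`). [folklore] -/
theorem prod_two_cosh_sub_two_cos (ω : ℝ) {t : ℕ} (ht : 0 < t) :
    ∏ q ∈ range t, (2 * Real.cosh ω - 2 * Real.cos (2 * Real.pi * q / t)) = 2 * Real.cosh (t * ω) - 2 := by
  have hu : (0 : ℝ) < Real.exp ω := Real.exp_pos ω
  set u := Real.exp ω with hudef
  have hcosh : 2 * Real.cosh ω = u + u⁻¹ := by rw [Real.cosh_eq, hudef, Real.exp_neg]; ring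
  have hcoshT : 2 * Real.cosh (t * ω) = u ^ t + (u ^ t)⁻¹ := by
    rw [Real.cosh_eq, hudef, ← Real.exp_nat_mul, Real.exp_neg, Real.exp_nat_mul]; ring
  have key := prod_sq_add_one_sub_cos u ht
  -- divide factorwise by u: (u² − 2u cos + 1) = u · (u + u⁻¹ − 2 cos)
  have hfac : ∀ q ∈ range t, (u ^ 2 - 2 * u * Real.cos (2 * Real.pi * q / t) + 1) =
      u * (2 * Real.cosh ω - 2 * Real.cos (2 * Real.pi * q / t)) := by
    intro q _; rw [hcosh]; field_simp; ring
  rw [Finset.prod_congr rfl hfac, Finset.prod_mul_distrib, Finset.prod_const, Finset.card_range] at key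
  have hut : u ^ t ≠ 0 := pow_ne_zero _ hu.ne'
  have hprod : ∏ q ∈ range t, (2 * Real.cosh ω - 2 * Real.cos (2 * Real.pi * q / t)) = (u ^ t - 1) ^ 2 / u ^ t := by
    rw [eq_div_iff hut, mul_comm]; exact key
  rw [hprod, hcoshT]
  field_simp
  ring

/-- `2 cosh x − 2 = e^x (1 − e^{−x})² = (2 sinh(x/2))²`: one harmonic mode of frequency `ω` at period `t` weighs `(2 sinh(ωt/2))^{−1}`. [folklore] -/
theorem two_cosh_sub_two (x : ℝ) : 2 * Real.cosh x - 2 = Real.exp x * (1 - Real.exp (-x)) ^ 2 := by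
  rw [Real.cosh_eq]
  have h : Real.exp x * Real.exp (-x) = 1 := by rw [← Real.exp_add, add_neg_cancel, Real.exp_zero]
  nlinarith [h, Real.exp_pos x, Real.exp_pos (-x), sq_nonneg (Real.exp (-x))]

/-! ## §2 The harmonic defect bound -/

/-- ★★ **THE HARMONIC DEFECT OBEYS T1's BOUND WITH UNIFORM CONSTANTS.**  For any finite family of rates `ω_λ ≥ ω_min` and any `t ≥ 0`:
`1 − ∏_λ ((1 − e^{−ω_λ t})/(1 + e^{−ω_λ t}))² ≤ 4 · #{λ} · e^{−ω_min t}`.  For the e₂-projected twisted `SU(N)` slab: `#{λ} = (N²−1)ℓ₀²·L`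
modes, `cosh ω_min = 1 + 2 sin²(π/(Nℓ₀))` — the one-loop value of `projSlabDefect` in the limit `β → ∞` (modulo the roadmap's slice step) is
`≤ 4(N²−1)ℓ₀² · L · e^{−ω_min t}`, uniformly in `L` and `t`. [folklore] -/
theorem harmonicDefect_le {ι : Type*} (s : Finset ι) (ω : ι → ℝ) {ωmin t : ℝ} (ht : 0 ≤ t)
    (hω : ∀ i ∈ s, ωmin ≤ ω i) :
    1 - ∏ i ∈ s, ((1 - Real.exp (-(ω i * t))) / (1 + Real.exp (-(ω i * t)))) ^ 2 ≤
      4 * s.card * Real.exp (-(ωmin * t)) := by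
  have hq : ∀ i ∈ s, 0 < Real.exp (-(ω i * t)) ∧ Real.exp (-(ω i * t)) ≤ Real.exp (-(ωmin * t)) := fun i hi =>
    ⟨Real.exp_pos _, Real.exp_le_exp.2 (by nlinarith [hω i hi])⟩
  refine (Literature.NumberTheory.DiophantineApproximation.HalandUD.one_sub_prod_le_sum s _ (fun i _ => sq_nonneg _)
    fun i hi => ?_).trans ?_
  · have q0 := (hq i hi).1
    rw [sq_le_one_iff_abs_le_one, abs_div, abs_of_pos (by linarith : 0 < 1 + Real.exp (-(ω i * t)))]
    rw [div_le_one (by linarith)]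
    exact abs_le.2 ⟨by linarith, by linarith⟩
  · have hterm : ∀ i ∈ s, 1 - ((1 - Real.exp (-(ω i * t))) / (1 + Real.exp (-(ω i * t)))) ^ 2 ≤
        4 * Real.exp (-(ωmin * t)) := by
      intro i hi
      obtain ⟨q0, q1⟩ := hq i hi
      set q := Real.exp (-(ω i * t))
      have hden : 0 < (1 + q) ^ 2 := by positivity
      have e : 1 - ((1 - q) / (1 + q)) ^ 2 = 4 * q / (1 + q) ^ 2 := by field_simp; ring
      rw [e, div_le_iff₀ hden]
      nlinarith [q0, q1, sq_nonneg q, mul_nonneg q0.le (Real.exp_pos (-(ωmin * t))).le]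
    calc ∑ i ∈ s, (1 - ((1 - Real.exp (-(ω i * t))) / (1 + Real.exp (-(ω i * t)))) ^ 2)
        ≤ ∑ i ∈ s, 4 * Real.exp (-(ωmin * t)) := Finset.sum_le_sum hterm
      _ = 4 * s.card * Real.exp (-(ωmin * t)) := by rw [Finset.sum_const, nsmul_eq_mul]; ring


end Summit.QuantumFields.YangMills.Cruxes.IRcof.TwistedSlab
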